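import Mathlib
import Literature.Computability.AlgebraicComplexity.StandardFamilies

/-!
# Crux `WordLengthQP` (stmt-ValiantsHypothesis-6623), line `Sketch` (eps-order-ladder) —
rung `q = 0` of the ε-order ladder is exact non-universality of S-affine width-2 products

The ε-order ladder `EpsOrderLadder` (the open, crux-equivalent stub `stub_ladder` of the line) asks,
jointly in the `ε`-order `q` and the length `L`, that `per_n` admit no border width-2 program over
`ℂ[ε][x̄]` with S-affine letters.  Its lowest rung `q = 0` is LENGTH-FREE: setting `ε = 0` turns a
program with `(0,0)` entry `per_n + ε · G` into an EXACT product of S-affine width-2 matrices over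
`ℂ[x̄]` with `(0,0)` entry `per_n`.  Hence the rung follows from the non-universality statement
"for `n ≥ n₀`, `per_n` is not the `(0,0)` entry of any product of width-2 matrices over `ℂ[x̄]` with
S-affine entries" — which is Allender–Wang 2016 (the quadratic form `x₁x₂ + ⋯ + x₁₅x₁₆` has no
width-2 algebraic branching program; quoted in Bringmann–Ikenmeyer–Zuiddam, J. ACM 65 (2018), §1)
composed with the universality of the permanent and the closure of S-affine products under
single-variable substitutions.  This file records the (elementary) reduction
`ladder_rung0_of_nonuniversal`, typed over existing declarations, for the planners' next items; it
does not touch the open rung itself.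
-/

-- `Summit.ValiantsHypothesis.ValiantsHypothesis.…` is the tree's mandated single-conjunct layout
-- (Sub = Summit), so the duplicated namespace component is intended.
set_option linter.dupNamespace false

noncomputable section

open MvPolynomial

namespace Summit.ValiantsHypothesis.ValiantsHypothesis.Cruxes.WordLengthQP.EpsOrderLadder

open Literature.Computability.AlgebraicComplexity

/-- Evaluating `ε ↦ x` maps an S-affine letter over `ℂ[ε][x̄]` (no degree bookkeeping) to an
S-affine letter over `ℂ[x̄]`. [folklore] -/
theorem rung0_sAffine_eval {σ : Type} (x : ℂ)
    (m : Matrix (Fin 2) (Fin 2) (MvPolynomial σ (Polynomial ℂ)))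
    (hm : ∀ i j : Fin 2, (∃ b : Polynomial ℂ, m i j = MvPolynomial.C b) ∨
      (∃ (a b : Polynomial ℂ) (v : σ),
        m i j = MvPolynomial.C a * MvPolynomial.X v + MvPolynomial.C b)) :
    ∀ i j : Fin 2,
      (∃ b : ℂ, (MvPolynomial.map (Polynomial.evalRingHom x)).mapMatrix m i j = MvPolynomial.C b) ∨
      (∃ (a b : ℂ) (v : σ), (MvPolynomial.map (Polynomial.evalRingHom x)).mapMatrix m i j =
        MvPolynomial.C a * MvPolynomial.X v + MvPolynomial.C b) := by
  intro i j
  rcases hm i j with ⟨b, hb⟩ | ⟨a, b, v, hab⟩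
  · exact Or.inl ⟨b.eval x, by simp [RingHom.mapMatrix_apply, hb, map_C]⟩
  · exact Or.inr ⟨a.eval x, b.eval x, v, by simp [RingHom.mapMatrix_apply, hab, map_C, map_X]⟩

/-- **Rung `q = 0` of the ε-order ladder from exact non-universality.**  If for all large `n` no
product of width-2 matrices over `ℂ[x̄]` with S-affine entries has `(0,0)` entry `per_n`
(Allender–Wang-type non-universality for the permanent), then for all large `n` no border width-2
S-affine program over `ℂ[ε][x̄]` — of ANY length — has `(0,0)` entry `per_n + ε · G`: set `ε = 0`.
[folklore] -/
theorem ladder_rung0_of_nonuniversal :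
    (∃ n₀ : ℕ, ∀ n ≥ n₀, ∀ ms : List (Matrix (Fin 2) (Fin 2) (MvPolynomial (Fin n × Fin n) ℂ)),
      (∀ m ∈ ms, ∀ i j : Fin 2, (∃ b : ℂ, m i j = MvPolynomial.C b) ∨
        (∃ (a b : ℂ) (v : Fin n × Fin n),
          m i j = MvPolynomial.C a * MvPolynomial.X v + MvPolynomial.C b)) →
      ms.prod 0 0 ≠ Literature.Computability.AlgebraicComplexity.perPoly (Fin n) ℂ) →
    ∃ n₀ : ℕ, ∀ n ≥ n₀,
      ¬ (∃ ms : List (Matrix (Fin 2) (Fin 2) (MvPolynomial (Fin n × Fin n) (Polynomial ℂ))),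
          (∀ m ∈ ms, ∀ i j : Fin 2, (∃ b : Polynomial ℂ, m i j = MvPolynomial.C b) ∨
            (∃ (a b : Polynomial ℂ) (v : Fin n × Fin n),
              m i j = MvPolynomial.C a * MvPolynomial.X v + MvPolynomial.C b)) ∧
          ∃ G : MvPolynomial (Fin n × Fin n) (Polynomial ℂ),
            ms.prod 0 0 = MvPolynomial.map Polynomial.C
                (Literature.Computability.AlgebraicComplexity.perPoly (Fin n) ℂ) +
              MvPolynomial.C Polynomial.X * G) := by
  rintro ⟨n₀, hn₀⟩
  refine ⟨n₀, fun n hn => ?_⟩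
  rintro ⟨ms, hS, G, hG⟩
  -- evaluate at `ε = 0`
  set φ : MvPolynomial (Fin n × Fin n) (Polynomial ℂ) →+* MvPolynomial (Fin n × Fin n) ℂ :=
    MvPolynomial.map (Polynomial.evalRingHom 0) with hφ
  refine hn₀ n hn (ms.map (fun m => φ.mapMatrix m)) ?_ ?_
  · intro m hm
    obtain ⟨m₀, hm₀, rfl⟩ := List.mem_map.1 hm
    exact rung0_sAffine_eval 0 m₀ (hS m₀ hm₀)
  · have hprod : (ms.map (fun m => φ.mapMatrix m)).prod = φ.mapMatrix ms.prod :=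
      (map_list_prod φ.mapMatrix ms).symm
    rw [hprod, RingHom.mapMatrix_apply, Matrix.map_apply, hG, map_add, map_mul, MvPolynomial.map_C,
      MvPolynomial.map_map]
    have hcomp : (Polynomial.evalRingHom (0 : ℂ)).comp Polynomial.C = RingHom.id ℂ := by
      ext a
      simp
    rw [hcomp, MvPolynomial.map_id]
    simp

end Summit.ValiantsHypothesis.ValiantsHypothesis.Cruxes.WordLengthQP.EpsOrderLadder
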